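import Literature.Computability.FineGrained.CliqueETHTMBridge
import Literature.Computability.FineGrained.SparsificationAlgorithm
import HarnessLib

/-!
# `k`-SAT from sparse `k`-SAT on Turing machines, keeping the exponent (Impagliazzo–Paturi–Zane, Cor. 2)

A sibling proof file of `NSETHNonReducibility.lean` (the decomposition of
`Literature.Computability.FineGrained.not_fgReducible_cnfSATWithSize_threeSUM_of_nseth`): it proves
step 3 of that decomposition, the *quantitative* form of Corollary 2 of Impagliazzo–Paturi–Zane
(JCSS 63 (2001)) on multi-stack Turing machines,

`kSATInExpTime_of_sparseKSATInExpTime_of_exponent`: for `ρ ≥ 0`, if for every density `c` and every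
`η > 0` the `k`-CNFs with at most `c · n` clauses are decidable in time `2^{(ρ+η)n} · poly(L)`
(`SparseKSATInExpTime k c (ρ + η)`), then `k`-SAT is decidable in time `2^{(ρ+η)n} · poly(L)` for
every `η > 0` (`KSATInExpTime k (ρ + η)`) —

which is literally the named fact `kSATInExpTime_of_sparseKSATInExpTime_quantitative` of
`NSETHNonReducibility.lean` (discharged there from this theorem). The proof is that of the
qualitative `kSATInExpTime_of_sparseKSATInExpTime` (`CliqueETHTMBridge.lean`, every `δ > 0` on
sparse instances gives every `δ > 0`) with the exponent `ρ` carried along: sparsify with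
`ε = η/3` by the PROVED sparsification lemma `sparsification_holds` (`SparsificationAlgorithm.lean`;
Thm. 1 / Cor. 1 of the source: at most `2^{ε n}` formulas on the same `n` variables with `≤ C n`
clauses each, computed in time `2^{ε n} poly(L)`), decide each produced formula with the density-`C`
machine of exponent `ρ + ε` (its input has length `O_{C,k}(n²)`, and `poly(n) ≤ C' 2^{ε n}`), and
accept iff one of them is accepted (`computesInTime_any`); the three exponents add up to
`ε + (ρ + ε) + ε = ρ + η`.

## References

* R. Impagliazzo, R. Paturi, F. Zane, *Which problems have strongly exponential complexity?*,
  JCSS 63 (2001) 512–530, §2: Thm. 1, Cor. 1 (sparsification), Cor. 2 (SERF-reduction of `k`-SAT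
  to sparse `k`-SAT).
* S. Arora, B. Barak, *Computational Complexity: A Modern Approach*, CUP 2009, §1.3 (machine
  composition).
-/

namespace Literature.Computability.FineGrained

open _root_.Computability Turing Real

/-- **Corollary 2 of Impagliazzo–Paturi–Zane on Turing machines, quantitative form (proved).**
For `ρ ≥ 0`: if for every density `c` and every `η > 0` the sparse `k`-CNFs of density `c` are
decidable in time `2^{(ρ+η)n} · poly(L)`, then `k`-SAT is decidable in time `2^{(ρ+η)n} · poly(L)`
for every `η > 0`. Sparsify with `ε = η/3` (`sparsification_holds`: at most `2^{ε n}` formulas on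
the same `n` variables with `≤ C n` clauses each, in time `2^{ε n} poly(L)`), decide each produced
formula with the density-`C` machine of exponent `ρ + ε` (input length `O_{C,k}(n²)`,
`KCNF.length_encode_succ_le_of_sparse`, and `(n+1)^a ≤ C₂ 2^{ε n}`, `exists_pow_le_two_rpow`), and
accept iff some produced formula is accepted (`computesInTime_any`).
[cite: ImpagliazzoPaturiZaneJCSS2001, Cor. 2 (with Thm. 1 / Cor. 1)] -/
theorem kSATInExpTime_of_sparseKSATInExpTime_of_exponent {k : ℕ} {ρ : ℝ} (hρ : 0 ≤ ρ)
    (h : ∀ (c : ℕ) (η : ℝ), 0 < η → SparseKSATInExpTime k c (ρ + η)) (η : ℝ) (hη : 0 < η) :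
    KSATInExpTime k (ρ + η) := by
  classical
  set ε : ℝ := η / 3 with hεdef
  have hε : 0 < ε := by positivity
  obtain ⟨C, F, T_F, hF, hT_F, hM_F⟩ := sparsification_holds k ε hε
  obtain ⟨T_D, hT_D, hM_D⟩ := h C ε hε
  -- the produced formulas are sparse of density `C`
  have hsp : ∀ φ, ∀ ψ ∈ F φ, ψ.clauses.length ≤ C * ψ.numVars := fun φ ψ hψ => by
    obtain ⟨hn, hc⟩ := (hF φ).2.1 ψ hψ
    rwa [hn]
  set F' : KCNF k → List (SparseKCNF k C) := fun φ => (F φ).pmap Subtype.mk (hsp φ) with hF'def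
  have hF'map : ∀ φ, (F' φ).map Subtype.val = F φ := fun φ => by
    rw [hF'def]
    exact map_val_pmap_mk (F φ) (hsp φ)
  have hM_F' : ComputesInTime KCNF.encode
      (fun l : List (SparseKCNF k C) => l.flatMap fun b => b.1.encode ++ [Γ'.blank]) F'
      fun φ => T_F φ.numVars φ.encode.length := by
    obtain ⟨M, hM⟩ := hM_F
    refine ⟨M, fun φ => ?_⟩
    have e : (F' φ).flatMap (fun b => b.1.encode ++ [Γ'.blank]) = KCNF.encodeList (F φ) := by
      rw [KCNF.encodeList_eq, ← hF'map φ, List.flatMap_map]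
    dsimp only
    rw [e]
    exact hM φ
  obtain ⟨c₅, hM₅⟩ := computesInTime_any (sep := Γ'.blank) (F := F')
    (Q := fun ψ : SparseKCNF k C => decide ψ.1.Satisfiable) (fun ψ => ψ.1.blank_not_mem_encode)
    hM_F' hM_D
  -- correctness
  have hcorr : ∀ φ : KCNF k,
      ((F' φ).any fun ψ => decide ψ.1.Satisfiable) = decide φ.Satisfiable := by
    intro φ
    have e : ((F' φ).any fun ψ => decide ψ.1.Satisfiable) =
        (F φ).any fun ψ => decide ψ.Satisfiable := by
      rw [← hF'map φ, List.any_map]; rfl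
    rw [e, Bool.eq_iff_iff, List.any_eq_true, decide_eq_true_iff]
    simp only [decide_eq_true_iff]
    rw [KCNF.satisfiable_iff_exists_eval]
    constructor
    · rintro ⟨ψ, hψ, hsat⟩
      obtain ⟨v, hv⟩ := (KCNF.satisfiable_iff_exists_eval ψ).1 hsat
      exact ⟨v, ((hF φ).2.2 v).2 ⟨ψ, hψ, hv⟩⟩
    · rintro ⟨v, hv⟩
      obtain ⟨ψ, hψ, hψv⟩ := ((hF φ).2.2 v).1 hv
      exact ⟨ψ, hψ, (KCNF.satisfiable_iff_exists_eval ψ).2 ⟨v, hψv⟩⟩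
  refine KCNF.kSATInExpTime_of_isExpPolyDom ?_ (hM₅.congr_fun hcorr)
  -- the time bound
  obtain ⟨c_D, hc_D⟩ := hT_D
  obtain ⟨C₂, hC₂0, hC₂⟩ := exists_pow_le_two_rpow (2 * c_D + 2) hε
  set A : ℝ := ((2 + 2 * C + 3 * C * k : ℕ) : ℝ) with hA
  have hA0 : (0 : ℝ) ≤ A := by rw [hA]; exact Nat.cast_nonneg _
  have hA1 : (1 : ℝ) ≤ A := by rw [hA]; exact_mod_cast (show 1 ≤ 2 + 2 * C + 3 * C * k by omega)
  have hρε : 0 ≤ ρ + ε := by positivity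
  -- per-entry bound
  set g : SparseKCNF k C → ℕ := fun b => T_D b.1.numVars b.1.encode.length + b.1.encode.length + 1
    with hgdef
  have hentry : ∀ φ : KCNF k, ∀ b ∈ F' φ,
      (g b : ℝ) ≤ (c_D + 1) * A ^ (c_D + 1) * C₂ *
        ((2 : ℝ) ^ ((ρ + ε) * φ.numVars) * (2 : ℝ) ^ (ε * φ.numVars)) := by
    intro φ b hb
    have hbF : b.1 ∈ F φ := by rw [← hF'map φ]; exact List.mem_map_of_mem hb
    obtain ⟨hn, -⟩ := (hF φ).2.1 b.1 hbF
    set n := φ.numVars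
    have hL : ((b.1.encode.length : ℝ) + 1) ≤ A * ((n : ℝ) + 1) ^ 2 := by
      have := KCNF.length_encode_succ_le_of_sparse b.1 b.2
      rw [hn] at this
      rw [hA]; exact_mod_cast this
    have hL0 : (0 : ℝ) ≤ (b.1.encode.length : ℝ) + 1 := by positivity
    have hT : (T_D b.1.numVars b.1.encode.length : ℝ) ≤
        c_D * (2 : ℝ) ^ ((ρ + ε) * n) * ((b.1.encode.length : ℝ) + 1) ^ c_D := by
      have := hc_D b.1.numVars b.1.encode.length
      rw [hn] at this ⊢
      exact this
    have hpow : ((b.1.encode.length : ℝ) + 1) ^ c_D ≤ A ^ c_D * ((n : ℝ) + 1) ^ (2 * c_D) := by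
      calc ((b.1.encode.length : ℝ) + 1) ^ c_D ≤ (A * ((n : ℝ) + 1) ^ 2) ^ c_D :=
            pow_le_pow_left₀ hL0 hL _
        _ = A ^ c_D * ((n : ℝ) + 1) ^ (2 * c_D) := by rw [mul_pow, ← pow_mul]
    have hn1 : (1 : ℝ) ≤ (n : ℝ) + 1 := by simp
    have hP : ((n : ℝ) + 1) ^ (2 * c_D) ≤ C₂ * (2 : ℝ) ^ (ε * n) :=
      (pow_le_pow_right₀ hn1 (by omega)).trans (hC₂ n)
    have hP2 : ((n : ℝ) + 1) ^ 2 ≤ C₂ * (2 : ℝ) ^ (ε * n) :=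
      (pow_le_pow_right₀ hn1 (by omega)).trans (hC₂ n)
    have hE1 : (1 : ℝ) ≤ (2 : ℝ) ^ ((ρ + ε) * n) := Real.one_le_rpow (by norm_num) (by positivity)
    have hAc : A ^ c_D ≤ A ^ (c_D + 1) := pow_le_pow_right₀ hA1 (Nat.le_succ _)
    have hA' : A ≤ A ^ (c_D + 1) := by
      calc A = A ^ 1 := (pow_one A).symm
        _ ≤ A ^ (c_D + 1) := pow_le_pow_right₀ hA1 (by omega)
    have hg : (g b : ℝ) = T_D b.1.numVars b.1.encode.length + ((b.1.encode.length : ℝ) + 1) := by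
      rw [hgdef]; push_cast; ring
    rw [hg]
    -- abbreviations for the two exponentials
    have hX0 : (0 : ℝ) ≤ (2 : ℝ) ^ ((ρ + ε) * n) := by positivity
    have hY0 : (0 : ℝ) ≤ (2 : ℝ) ^ (ε * n) := by positivity
    calc (T_D b.1.numVars b.1.encode.length : ℝ) + ((b.1.encode.length : ℝ) + 1)
        ≤ c_D * (2 : ℝ) ^ ((ρ + ε) * n) * ((b.1.encode.length : ℝ) + 1) ^ c_D +
            A * ((n : ℝ) + 1) ^ 2 := add_le_add hT hL
      _ ≤ c_D * (2 : ℝ) ^ ((ρ + ε) * n) * (A ^ c_D * ((n : ℝ) + 1) ^ (2 * c_D)) +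
            A * ((n : ℝ) + 1) ^ 2 := by gcongr
      _ ≤ c_D * (2 : ℝ) ^ ((ρ + ε) * n) * (A ^ (c_D + 1) * (C₂ * (2 : ℝ) ^ (ε * n))) +
            A ^ (c_D + 1) * (C₂ * (2 : ℝ) ^ (ε * n)) := by gcongr
      _ ≤ c_D * (2 : ℝ) ^ ((ρ + ε) * n) * (A ^ (c_D + 1) * (C₂ * (2 : ℝ) ^ (ε * n))) +
            A ^ (c_D + 1) * (C₂ * (2 : ℝ) ^ (ε * n)) * (2 : ℝ) ^ ((ρ + ε) * n) := by
          have h0 : (0 : ℝ) ≤ A ^ (c_D + 1) * (C₂ * (2 : ℝ) ^ (ε * n)) := by positivity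
          nlinarith
      _ = (c_D + 1) * A ^ (c_D + 1) * C₂ *
            ((2 : ℝ) ^ ((ρ + ε) * n) * (2 : ℝ) ^ (ε * n)) := by ring
  -- the sum over the produced list
  have hsum : KCNF.IsExpPolyDom (ρ + η) fun φ : KCNF k => ((((F' φ).map g).sum : ℕ) : ℝ) := by
    refine ⟨⌈(c_D + 1) * A ^ (c_D + 1) * C₂⌉₊, 0, fun φ => ?_⟩
    set n := φ.numVars
    set K : ℝ := (c_D + 1) * A ^ (c_D + 1) * C₂ with hK
    have hK0 : 0 ≤ K := by positivity
    set E : ℝ := (2 : ℝ) ^ ((ρ + ε) * n) * (2 : ℝ) ^ (ε * n) with hEdef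
    have h1 : ((((F' φ).map g).sum : ℕ) : ℝ) ≤ ((F' φ).length : ℝ) * (K * E) := by
      have := List.sum_le_card_nsmul (((F' φ).map g).map (fun x : ℕ => (x : ℝ)))
        (K * E) (by
          intro x hx
          obtain ⟨y, hy, rfl⟩ := List.mem_map.1 hx
          obtain ⟨b, hb, rfl⟩ := List.mem_map.1 hy
          exact hentry φ b hb)
      rw [Nat.cast_list_sum]
      simpa [nsmul_eq_mul] using this
    have hlen : ((F' φ).length : ℝ) ≤ (2 : ℝ) ^ (ε * n) := by
      have := (hF φ).1
      rw [← hF'map φ, List.length_map] at this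
      exact this
    have e3 : (2 : ℝ) ^ (ε * n) * E = (2 : ℝ) ^ ((ρ + η) * n) := by
      rw [hEdef, ← Real.rpow_add (by norm_num), ← Real.rpow_add (by norm_num)]
      congr 1; rw [hεdef]; ring
    have hE0 : 0 ≤ E := by positivity
    calc ((((F' φ).map g).sum : ℕ) : ℝ) ≤ ((F' φ).length : ℝ) * (K * E) := h1
      _ ≤ (2 : ℝ) ^ (ε * n) * (K * E) := by gcongr
      _ = K * ((2 : ℝ) ^ (ε * n) * E) := by ring
      _ = K * (2 : ℝ) ^ ((ρ + η) * n) := by rw [e3]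
      _ ≤ ⌈K⌉₊ * (2 : ℝ) ^ ((ρ + η) * n) := by gcongr; exact Nat.le_ceil K
      _ = ((⌈K⌉₊ : ℕ) : ℝ) * (2 : ℝ) ^ ((ρ + η) * n) * (((φ.encode.length : ℝ) + 1) ^ 0) := by
          rw [pow_zero, mul_one]
  have hερη : ε ≤ ρ + η := by rw [hεdef]; linarith
  have hρη : 0 ≤ ρ + η := by positivity
  have hdom : KCNF.IsExpPolyDom (ρ + η) fun φ : KCNF k =>
      ((c₅ * (T_F φ.numVars φ.encode.length + ((F' φ).map g).sum + φ.encode.length + 1) : ℕ) : ℝ) := by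
    have h1 : KCNF.IsExpPolyDom (ρ + η) fun φ : KCNF k => (T_F φ.numVars φ.encode.length : ℝ) :=
      (KCNF.IsExpPolyDom.of_isExpPolyBound hT_F).mono hερη
    have h3 : KCNF.IsExpPolyDom (ρ + η) fun φ : KCNF k => (φ.encode.length : ℝ) + 1 :=
      KCNF.IsExpPolyDom.length_succ hρη
    have := KCNF.IsExpPolyDom.const_mul (c₅ : ℝ) (Nat.cast_nonneg _) ((h1.add hsum).add h3)
    refine this.of_le fun φ => le_of_eq ?_
    push_cast; ring
  exact hdom

end Literature.Computability.FineGrained
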